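import Summits.QuantumFields.YangMills.Theorems.BalabanUVNodesN15TwoSpacingGluingCurvedKnitCovariantLandauNodeFlatRows
import HarnessLib

/-!
# N15 = NE2 — dag-n15-a g33, PROGRAMME ♭ «FLAT ROWS», (♭-1): n15-c∕207b's THREE THRESHOLDED GLOBAL LANDAU ROWS FROM n15-c∕219's DISPLAYED PRIMITIVE DATA — NAMED (unit-weight mass and
# mass-window editions), so that ONE display feeds the operator, the site AND the unit layer of the (P-R) one-propagator literal
# (dag-n15-a g33, (♭-1); node N15 = NE2; `--supports stmt-QuantumFields-27366 --as helper`, count-neutral; two theorems; imports n15-c∕219 only)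

WHY.  n15-c∕219 `ne2PlusOperator_sfqr_of_flatRows(_mass)` (p744230) closed the OPERATOR layer of dag-n15-c's (P-R) family from PRIMITIVE displayed data — per grid the four FLAT rows
{`G′(1)`, `G′(1)∂ᵀ`, `∂G′(1)`, `(Q′G′²Q′ᵀ)⁻¹(1)`} ([Balaban1984PropagatorsII] Props. 2.2–2.3 = [B9] Thms 3.1–3.2 at `U ≡ 1`), the ONE covariant gradient-difference row `D_TG′(T) − ∂G′(1)`
([B9] Thm 3.4), the two-grid η-defect row of `N_V^R`, and entries 1–3 — by reducing them INLINE to n15-c∕207b's three thresholded global Landau rows `hG`.  dag-n15-a's (t2) F5∕F6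
(p744232∕p744574: the (P-R) propagator `X_r` inside the site ∕ unit sandwiches and the all-layers literal `sfObjects₇qvr`) still display n15-c∕211's three cut-off-free rows.  For the
site and unit layers to read the SAME primitive display as the operator layer, 219's reduction must be a NAMED lemma: this file states it, with 219's proof text (minus its last line).

WHAT.  ★★ `landauRows_small_of_flatRows (hL) (ha) (hc35) (hF) (hD) : ∃ δR cR CR γR aG, …` — conclusion = n15-c∕207b `ne2PlusOperator_sfqr_of_global_small`'s hypothesis `hG` LITERALLY,
hypotheses `hF`, `hD` = n15-c∕219's LITERALLY (mass `n^{d+1}`); ★★ `landauRows_small_of_flatRows_mass` — the same for 219 v1.1's mass-window `hF` (`a_w·n^{d+1}`, `0 < a_w ≤ 1` per index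
and grid).  Consistency (not restated as a theorem, to stay dedup-clean): `ne2PlusOperator_sfqr_of_flatRows … E hE hF hD` = `ne2PlusOperator_sfqr_of_global_small … E hE
(landauRows_small_of_flatRows hL ha hc35 hF hD)` up to proof irrelevance.  Sequel (♭-2)∕(♭-3): F5 `rows_sfqr` on the thresholded socket and the knit.

HONEST FRAMING ∕ LIMITS.  Bookkeeping on dag-n15-c's MODEL carriers (doubled-torus cover `2L^{m+1}`, global small-field gauge, one averaging level, unit weights, site transporters, crude
constants); the flat rows, the gradient-difference rows and the two-grid defect row are HYPOTHESES (n15-c∕220 is discharging three of the four flat rows from the King-model rung; the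
`S⁻¹` row, the Schauder-type row and the defect row stay displayed); NOT [Balaban1985BackgroundPropagators] Thms 3.1–3.4 ∕ (3.49) as printed and no estimate of Bałaban's; NE2⁺ NOT
PRINTED; N15 stays DISCHARGED OF RECORD 8∕27 AS CONSUMED (U-blind v7 pin, p687738) — nothing re-claimed, no count moved; K3⁸ OPEN; finite 𝕋⁴ per index — NOT ℝ⁴ ∕ OS ∕ mass gap ∕ Clay.
No `sorry`, `instance`, `notation`; standard axioms.  Restate-immune (no Theses import).
-/

noncomputable section

open scoped BigOperators Matrix

namespace Summit.QuantumFields.YangMills.BalabanUVNodes.N15.Gluing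

open Literature.MathematicalPhysics.QuantumFieldTheory.Balaban1983to89
open Literature.MathematicalPhysics.QuantumFieldTheory.Balaban1983to89.B11SectG (BlockNorm HasMaj)
open Literature.MathematicalPhysics.QuantumFieldTheory.Balaban1983to89.T4EtaRateDefect (idef)
open Literature.MathematicalPhysics.QuantumFieldTheory.Balaban1983to89.T4EtaRateCoeffDefect (pull)
open Literature.MathematicalPhysics.QuantumFieldTheory.Balaban1983to89.B6UnitTorusCarrier (unitTorusGeo unitTorusGeo_dist_nonneg)
open Literature.MathematicalPhysics.QuantumFieldTheory.Balaban1983to89.B5Prop11Plancherel (Tor fine)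
open Literature.MathematicalPhysics.QuantumFieldTheory.Balaban1983to89.T4EtaRate (NE2PlusOperator rateFactor)
open Literature.MathematicalPhysics.QuantumFieldTheory.King1986.Torus (blockOf tdistT)
open Literature.Barriers.QuantumFields (traceForm)
open Summit.QuantumFields.YangMills.BalabanUVNodes.N15.BackgroundLayer (gavgM)
open Summit.QuantumFields.YangMills.BalabanUVNodes.N15.VectorPiece (kingPrV blkFine_comp_kingPrV)
open Summit.QuantumFields.YangMills.BalabanUVNodes.N15.MatrixSpecies (liftBlk liftMap basisConst basisConst_nonneg)
open Summit.QuantumFields.YangMills.BalabanUVNodes.N15.OperatorReadout (opGeo)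
open Summit.QuantumFields.YangMills.BalabanUVNodes.N15.CovLandau (cgrad csavg cGreen cSop landauCov landauSmallConst landauRowConst landauLetterConst_nonneg landauCov_eq_of_mass landauCov_one_eq mulVecLin_sub')
open Summit.QuantumFields.YangMills.BalabanUVNodes.N15.CurvedSpecies (exp_smul_unitary_of_conjTranspose)
open Summit.QuantumFields.YangMills.BalabanUVNodes.N15.SiteLayerSf (norm_gavgM_le_of_norm_le)

variable {d : ℕ} {L : ℕ} [NeZero L]

section Node

open scoped Matrix.Norms.L2Operator

variable (d) (mm ι : Type) [Fintype mm] [DecidableEq mm] [Nonempty mm] [Fintype ι] [DecidableEq ι] (e : Matrix mm mm ℂ ≃L[ℝ] (ι → ℝ))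

/-- ★★ **THE THREE THRESHOLDED GLOBAL LANDAU ROWS OF n15-c∕207b FROM n15-c∕219's DISPLAYED PRIMITIVE DATA** (n15-c∕219 `ne2PlusOperator_sfqr_of_flatRows`'s own reduction, NAMED so
that the site and unit layers of the (P-R) one-propagator literal consume the SAME display): for odd `L`, `a, c₃₅ > 0` and coordinates `e`, the four FLAT rows per grid at the unit-weight
mass `n^{d+1}` (`hF`, first two blocks), the ONE covariant gradient-difference row per grid below `a_P` (`hF`, third block) and the two-grid η-defect row of `N_V^R` below `a_D` (`hD`) give
n15-c∕207b's hypothesis `hG` LITERALLY: `∃ δ_R c_R C_R γ_R a_G`, the coarse row `N_V^R(e^{ηĀ′}) ≤ c_R·r_A·e^{−δ_R d}`, the fine row `N_V^R′(e^{η′A′}) ≤ c_R·r_A·e^{−δ_R d}` and the defect row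
`𝔇(N_V^R′, N_V^R) ≤ C_R(L^k)^{−γ_R}e^{−δ_R d}` for every index, every `α₀ > 0` with `L^mα₀ ≤ a_G` and every class-(3.35) field — `δ_R = min(3δ_F∕8, δ_D)`, `c_R = landauRowConst(…)`,
`a_G = min(a_P, a_D, landauExpThreshold∕c₃₅)`; n15-c∕218 on both grids, mass moved by n15-c∕210, fine block map = King's (`blkFine_comp_kingPrV`).  Proof text = n15-c∕219's, minus its
last line.  MODEL; the rows are HYPOTHESES; NOT [B9] Thms 3.1–3.4 as printed.
[cite: Balaban1985BackgroundPropagators, (3.49) p.399, Thm 3.4 p.400, (3.25)–(3.26) pp.394–395, (3.35)–(3.37) p.396 (shape); Balaban1984PropagatorsII, Props. 2.2–2.3 pp.228–231 (the flat rows' shape)] -/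
theorem landauRows_small_of_flatRows (hL : Odd L ∧ 1 < L) {a : ℝ} (ha : 0 < a) {c35 : ℝ} (hc35 : 0 < c35)
    (hF : ∃ δF CG CA CD CS P0 aP : ℝ, 0 < δF ∧ 0 ≤ CG ∧ 0 ≤ CA ∧ 0 ≤ CD ∧ 0 ≤ CS ∧ 0 ≤ P0 ∧ 0 < aP ∧ ∀ i : SfIdx d L,
        (HasMaj (BlockNorm.ofBlocks (unitTorusGeo L i.kk (cvM d L i.m i.kk hL)) (liftBlk (blockOf (L ^ i.kk) (cvM d L i.m i.kk hL)) ι)) (BlockNorm.ofBlocks (unitTorusGeo L i.kk (cvM d L i.m i.kk hL)) (liftBlk (blockOf (L ^ i.kk) (cvM d L i.m i.kk hL)) ι)) (Matrix.mulVecLin (cGreen (cvM d L i.m i.kk hL) (L ^ i.kk) (fun (_ : Fin (d + 1)) (_ : Tor (fine (L ^ i.kk) (cvM d L i.m i.kk hL))) => (1 : Matrix ι ι ℝ)) (((L ^ i.kk : ℕ) : ℝ) ^ (d + 1)))) (fun y y' => CG * Real.exp (-(δF * (unitTorusGeo L i.kk (cvM d L i.m i.kk hL)).dist y y'))) ∧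
          HasMaj (BlockNorm.ofBlocks (unitTorusGeo L i.kk (cvM d L i.m i.kk hL)) (liftBlk (fun b : Tor (fine (L ^ i.kk) (cvM d L i.m i.kk hL)) × Fin (d + 1) => blockOf (L ^ i.kk) (cvM d L i.m i.kk hL) b.1) ι)) (BlockNorm.ofBlocks (unitTorusGeo L i.kk (cvM d L i.m i.kk hL)) (liftBlk (blockOf (L ^ i.kk) (cvM d L i.m i.kk hL)) ι)) (Matrix.mulVecLin (cGreen (cvM d L i.m i.kk hL) (L ^ i.kk) (fun (_ : Fin (d + 1)) (_ : Tor (fine (L ^ i.kk) (cvM d L i.m i.kk hL))) => (1 : Matrix ι ι ℝ)) (((L ^ i.kk : ℕ) : ℝ) ^ (d + 1)) * (cgrad (cvM d L i.m i.kk hL) (L ^ i.kk) (fun (_ : Fin (d + 1)) (_ : Tor (fine (L ^ i.kk) (cvM d L i.m i.kk hL))) => (1 : Matrix ι ι ℝ)))ᵀ)) (fun y y' => CA * Real.exp (-(δF * (unitTorusGeo L i.kk (cvM d L i.m i.kk hL)).dist y y'))) ∧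
          HasMaj (BlockNorm.ofBlocks (unitTorusGeo L i.kk (cvM d L i.m i.kk hL)) (liftBlk (blockOf (L ^ i.kk) (cvM d L i.m i.kk hL)) ι)) (BlockNorm.ofBlocks (unitTorusGeo L i.kk (cvM d L i.m i.kk hL)) (liftBlk (fun b : Tor (fine (L ^ i.kk) (cvM d L i.m i.kk hL)) × Fin (d + 1) => blockOf (L ^ i.kk) (cvM d L i.m i.kk hL) b.1) ι)) (Matrix.mulVecLin (cgrad (cvM d L i.m i.kk hL) (L ^ i.kk) (fun (_ : Fin (d + 1)) (_ : Tor (fine (L ^ i.kk) (cvM d L i.m i.kk hL))) => (1 : Matrix ι ι ℝ)) * cGreen (cvM d L i.m i.kk hL) (L ^ i.kk) (fun (_ : Fin (d + 1)) (_ : Tor (fine (L ^ i.kk) (cvM d L i.m i.kk hL))) => (1 : Matrix ι ι ℝ)) (((L ^ i.kk : ℕ) : ℝ) ^ (d + 1)))) (fun y y' => CD * Real.exp (-(δF * (unitTorusGeo L i.kk (cvM d L i.m i.kk hL)).dist y y'))) ∧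
          HasMaj (BlockNorm.ofBlocks (unitTorusGeo L i.kk (cvM d L i.m i.kk hL)) (liftBlk (fun y : Tor (cvM d L i.m i.kk hL) => y) ι)) (BlockNorm.ofBlocks (unitTorusGeo L i.kk (cvM d L i.m i.kk hL)) (liftBlk (fun y : Tor (cvM d L i.m i.kk hL) => y) ι)) (Matrix.mulVecLin (cSop (cvM d L i.m i.kk hL) (L ^ i.kk) (fun (_ : Fin (d + 1)) (_ : Tor (fine (L ^ i.kk) (cvM d L i.m i.kk hL))) => (1 : Matrix ι ι ℝ)) (((L ^ i.kk : ℕ) : ℝ) ^ (d + 1)))⁻¹) (fun y y' => CS * ((L ^ i.kk : ℕ) : ℝ) ^ (d + 1) * Real.exp (-(δF * (unitTorusGeo L i.kk (cvM d L i.m i.kk hL)).dist y y')))) ∧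
        (HasMaj (BlockNorm.ofBlocks (unitTorusGeo L i.kk (cvM d L i.m i.kk hL)) (liftBlk (blockOf (L ^ i.r * L ^ i.kk) (cvM d L i.m i.kk hL)) ι)) (BlockNorm.ofBlocks (unitTorusGeo L i.kk (cvM d L i.m i.kk hL)) (liftBlk (blockOf (L ^ i.r * L ^ i.kk) (cvM d L i.m i.kk hL)) ι)) (Matrix.mulVecLin (cGreen (cvM d L i.m i.kk hL) (L ^ i.r * L ^ i.kk) (fun (_ : Fin (d + 1)) (_ : Tor (fine (L ^ i.r * L ^ i.kk) (cvM d L i.m i.kk hL))) => (1 : Matrix ι ι ℝ)) (((L ^ i.r * L ^ i.kk : ℕ) : ℝ) ^ (d + 1)))) (fun y y' => CG * Real.exp (-(δF * (unitTorusGeo L i.kk (cvM d L i.m i.kk hL)).dist y y'))) ∧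
          HasMaj (BlockNorm.ofBlocks (unitTorusGeo L i.kk (cvM d L i.m i.kk hL)) (liftBlk (fun b : Tor (fine (L ^ i.r * L ^ i.kk) (cvM d L i.m i.kk hL)) × Fin (d + 1) => blockOf (L ^ i.r * L ^ i.kk) (cvM d L i.m i.kk hL) b.1) ι)) (BlockNorm.ofBlocks (unitTorusGeo L i.kk (cvM d L i.m i.kk hL)) (liftBlk (blockOf (L ^ i.r * L ^ i.kk) (cvM d L i.m i.kk hL)) ι)) (Matrix.mulVecLin (cGreen (cvM d L i.m i.kk hL) (L ^ i.r * L ^ i.kk) (fun (_ : Fin (d + 1)) (_ : Tor (fine (L ^ i.r * L ^ i.kk) (cvM d L i.m i.kk hL))) => (1 : Matrix ι ι ℝ)) (((L ^ i.r * L ^ i.kk : ℕ) : ℝ) ^ (d + 1)) * (cgrad (cvM d L i.m i.kk hL) (L ^ i.r * L ^ i.kk) (fun (_ : Fin (d + 1)) (_ : Tor (fine (L ^ i.r * L ^ i.kk) (cvM d L i.m i.kk hL))) => (1 : Matrix ι ι ℝ)))ᵀ)) (fun y y' => CA * Real.exp (-(δF * (unitTorusGeo L i.kk (cvM d L i.m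 i.kk hL)).dist y y'))) ∧
          HasMaj (BlockNorm.ofBlocks (unitTorusGeo L i.kk (cvM d L i.m i.kk hL)) (liftBlk (blockOf (L ^ i.r * L ^ i.kk) (cvM d L i.m i.kk hL)) ι)) (BlockNorm.ofBlocks (unitTorusGeo L i.kk (cvM d L i.m i.kk hL)) (liftBlk (fun b : Tor (fine (L ^ i.r * L ^ i.kk) (cvM d L i.m i.kk hL)) × Fin (d + 1) => blockOf (L ^ i.r * L ^ i.kk) (cvM d L i.m i.kk hL) b.1) ι)) (Matrix.mulVecLin (cgrad (cvM d L i.m i.kk hL) (L ^ i.r * L ^ i.kk) (fun (_ : Fin (d + 1)) (_ : Tor (fine (L ^ i.r * L ^ i.kk) (cvM d L i.m i.kk hL))) => (1 : Matrix ι ι ℝ)) * cGreen (cvM d L i.m i.kk hL) (L ^ i.r * L ^ i.kk) (fun (_ : Fin (d + 1)) (_ : Tor (fine (L ^ i.r * L ^ i.kk) (cvM d L i.m i.kk hL))) => (1 : Matrix ι ι ℝ)) (((L ^ i.r * L ^ i.kk : ℕ) : ℝ) ^ (d + 1)))) (fun y y' => CD * Real.exp (-(δF * (unitTorusGeo L i.kk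 (cvM d L i.m i.kk hL)).dist y y'))) ∧
          HasMaj (BlockNorm.ofBlocks (unitTorusGeo L i.kk (cvM d L i.m i.kk hL)) (liftBlk (fun y : Tor (cvM d L i.m i.kk hL) => y) ι)) (BlockNorm.ofBlocks (unitTorusGeo L i.kk (cvM d L i.m i.kk hL)) (liftBlk (fun y : Tor (cvM d L i.m i.kk hL) => y) ι)) (Matrix.mulVecLin (cSop (cvM d L i.m i.kk hL) (L ^ i.r * L ^ i.kk) (fun (_ : Fin (d + 1)) (_ : Tor (fine (L ^ i.r * L ^ i.kk) (cvM d L i.m i.kk hL))) => (1 : Matrix ι ι ℝ)) (((L ^ i.r * L ^ i.kk : ℕ) : ℝ) ^ (d + 1)))⁻¹) (fun y y' => CS * ((L ^ i.r * L ^ i.kk : ℕ) : ℝ) ^ (d + 1) * Real.exp (-(δF * (unitTorusGeo L i.kk (cvM d L i.m i.kk hL)).dist y y')))) ∧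
        (∀ α₀ : ℝ, 0 < α₀ → (L : ℝ) ^ i.m * α₀ ≤ aP → ∀ A' : Fin (d + 1) → CvX' d L i.m i.kk i.r hL → Matrix mm mm ℂ, (sfInstance d mm ι hL i).Bf.Reg335 c35 α₀ A' →
          HasMaj (BlockNorm.ofBlocks (unitTorusGeo L i.kk (cvM d L i.m i.kk hL)) (liftBlk (blockOf (L ^ i.kk) (cvM d L i.m i.kk hL)) ι)) (BlockNorm.ofBlocks (unitTorusGeo L i.kk (cvM d L i.m i.kk hL)) (liftBlk (fun b : Tor (fine (L ^ i.kk) (cvM d L i.m i.kk hL)) × Fin (d + 1) => blockOf (L ^ i.kk) (cvM d L i.m i.kk hL) b.1) ι)) (Matrix.mulVecLin (cgrad (cvM d L i.m i.kk hL) (L ^ i.kk) (cvT₀ e (fun μ x => NormedSpace.exp (((((L ^ i.kk : ℕ) : ℝ))⁻¹) • gavgM (Matrix mm mm ℂ) (Fin (d + 1)) (kingPrV L i.kk i.r (cvM d L i.m i.kk hL)) A' μ x))) * cGreen (cvM d L i.m i.kk hL) (L ^ i.kk) (cvT₀ e (fun μ x => NormedSpace.exp (((((L ^ i.kk : ℕ)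 : ℝ))⁻¹) • gavgM (Matrix mm mm ℂ) (Fin (d + 1)) (kingPrV L i.kk i.r (cvM d L i.m i.kk hL)) A' μ x))) (((L ^ i.kk : ℕ) : ℝ) ^ (d + 1)) - cgrad (cvM d L i.m i.kk hL) (L ^ i.kk) (fun (_ : Fin (d + 1)) (_ : Tor (fine (L ^ i.kk) (cvM d L i.m i.kk hL))) => (1 : Matrix ι ι ℝ)) * cGreen (cvM d L i.m i.kk hL) (L ^ i.kk) (fun (_ : Fin (d + 1)) (_ : Tor (fine (L ^ i.kk) (cvM d L i.m i.kk hL))) => (1 : Matrix ι ι ℝ)) (((L ^ i.kk : ℕ) : ℝ) ^ (d + 1)))) (fun y y' => P0 * (c35 * (L : ℝ) ^ i.m * α₀) * Real.exp (-(δF * (unitTorusGeo L i.kk (cvM d L i.m i.kk hL)).dist y y'))) ∧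
          HasMaj (BlockNorm.ofBlocks (unitTorusGeo L i.kk (cvM d L i.m i.kk hL)) (liftBlk (blockOf (L ^ i.r * L ^ i.kk) (cvM d L i.m i.kk hL)) ι)) (BlockNorm.ofBlocks (unitTorusGeo L i.kk (cvM d L i.m i.kk hL)) (liftBlk (fun b : Tor (fine (L ^ i.r * L ^ i.kk) (cvM d L i.m i.kk hL)) × Fin (d + 1) => blockOf (L ^ i.r * L ^ i.kk) (cvM d L i.m i.kk hL) b.1) ι)) (Matrix.mulVecLin (cgrad (cvM d L i.m i.kk hL) (L ^ i.r * L ^ i.kk) (cvT₀ e (fun μ x' => NormedSpace.exp (((((L ^ i.r * L ^ i.kk : ℕ) : ℝ))⁻¹) • A' μ x'))) * cGreen (cvM d L i.m i.kk hL) (L ^ i.r * L ^ i.kk) (cvT₀ e (fun μ x' => NormedSpace.exp (((((L ^ i.r * L ^ i.kk : ℕ) : ℝ))⁻¹) • A' μ x'))) (((L ^ i.r * L ^ i.kk : ℕ) : ℝ) ^ (d + 1)) - cgrad (cvM d L i.m i.kk hL) (L ^ i.r * L ^ i.kk) (fun (_ : Fin (d + 1)) (_ : Tor (fine (L ^ i.r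 * L ^ i.kk) (cvM d L i.m i.kk hL))) => (1 : Matrix ι ι ℝ)) * cGreen (cvM d L i.m i.kk hL) (L ^ i.r * L ^ i.kk) (fun (_ : Fin (d + 1)) (_ : Tor (fine (L ^ i.r * L ^ i.kk) (cvM d L i.m i.kk hL))) => (1 : Matrix ι ι ℝ)) (((L ^ i.r * L ^ i.kk : ℕ) : ℝ) ^ (d + 1)))) (fun y y' => P0 * (c35 * (L : ℝ) ^ i.m * α₀) * Real.exp (-(δF * (unitTorusGeo L i.kk (cvM d L i.m i.kk hL)).dist y y')))))
    (hD : ∃ δD CR γR aD : ℝ, 0 < δD ∧ 0 ≤ CR ∧ 0 < γR ∧ 0 < aD ∧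
      ∀ i : SfIdx d L, ∀ α₀ : ℝ, 0 < α₀ → (L : ℝ) ^ i.m * α₀ ≤ aD → ∀ A' : Fin (d + 1) → CvX' d L i.m i.kk i.r hL → Matrix mm mm ℂ, (sfInstance d mm ι hL i).Bf.Reg335 c35 α₀ A' →
        HasMaj (CvNorm d L i.m i.kk hL ι) (BlockNorm.ofBlocks (unitTorusGeo L i.kk (cvM d L i.m i.kk hL)) (liftBlk (cvBlk d L i.m i.kk hL ∘ (kingPrV L i.kk i.r (cvM d L i.m i.kk hL))) ι)) (idef (pull (liftMap (kingPrV L i.kk i.r (cvM d L i.m i.kk hL)) ι)) (pull (liftMap (kingPrV L i.kk i.r (cvM d L i.m i.kk hL)) ι)) (cvNVr' d L i.m i.kk i.r hL a ι e (fun μ x' => NormedSpace.exp (((((L ^ i.r * L ^ i.kk : ℕ) : ℝ))⁻¹) • A' μ x'))) (cvNVr d L i.m i.kk hL a ι e (fun μ x => NormedSpace.exp (((((L ^ i.kk : ℕ) : ℝ))⁻¹) • gavgM (Matrix mm mm ℂ) (Fin (d + 1)) (kingPrV L i.kk i.r (cvM d L i.m i.kk hL)) A' μ x)))) (fun y y'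 => (CR * ((L : ℝ) ^ i.kk) ^ (-γR)) * Real.exp (-(δD * (unitTorusGeo L i.kk (cvM d L i.m i.kk hL)).dist y y')))) :
    ∃ δR cR CR γR aG : ℝ, 0 < δR ∧ 0 ≤ cR ∧ 0 ≤ CR ∧ 0 < γR ∧ 0 < aG ∧
      ∀ i : SfIdx d L, ∀ α₀ : ℝ, 0 < α₀ → (L : ℝ) ^ i.m * α₀ ≤ aG → ∀ A' : Fin (d + 1) → CvX' d L i.m i.kk i.r hL → Matrix mm mm ℂ, (sfInstance d mm ι hL i).Bf.Reg335 c35 α₀ A' →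
        HasMaj (CvNorm d L i.m i.kk hL ι) (CvNorm d L i.m i.kk hL ι) (cvNVr d L i.m i.kk hL a ι e (fun μ x => NormedSpace.exp (((((L ^ i.kk : ℕ) : ℝ))⁻¹) • gavgM (Matrix mm mm ℂ) (Fin (d + 1)) (kingPrV L i.kk i.r (cvM d L i.m i.kk hL)) A' μ x))) (fun y y' => (cR * (c35 * (L : ℝ) ^ i.m * α₀)) * Real.exp (-(δR * (unitTorusGeo L i.kk (cvM d L i.m i.kk hL)).dist y y'))) ∧
        HasMaj (BlockNorm.ofBlocks (unitTorusGeo L i.kk (cvM d L i.m i.kk hL)) (liftBlk (cvBlk d L i.m i.kk hL ∘ (kingPrV L i.kk i.r (cvM d L i.m i.kk hL))) ι)) (BlockNorm.ofBlocks (unitTorusGeo L i.kk (cvM d L i.m i.kk hL)) (liftBlk (cvBlk d L i.m i.kk hL ∘ (kingPrV L i.kk i.r (cvM d L i.m i.kk hL))) ι)) (cvNVr' d L i.m i.kk i.r hL a ι e (fun μ x' => NormedSpace.exp (((((L ^ i.r * L ^ i.kk : ℕ) : ℝ))⁻¹) • A' μ x'))) (fun y y' => (cR * (c35 * (L : ℝ)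 ^ i.m * α₀)) * Real.exp (-(δR * (unitTorusGeo L i.kk (cvM d L i.m i.kk hL)).dist y y'))) ∧
        HasMaj (CvNorm d L i.m i.kk hL ι) (BlockNorm.ofBlocks (unitTorusGeo L i.kk (cvM d L i.m i.kk hL)) (liftBlk (cvBlk d L i.m i.kk hL ∘ (kingPrV L i.kk i.r (cvM d L i.m i.kk hL))) ι)) (idef (pull (liftMap (kingPrV L i.kk i.r (cvM d L i.m i.kk hL)) ι)) (pull (liftMap (kingPrV L i.kk i.r (cvM d L i.m i.kk hL)) ι)) (cvNVr' d L i.m i.kk i.r hL a ι e (fun μ x' => NormedSpace.exp (((((L ^ i.r * L ^ i.kk : ℕ) : ℝ))⁻¹) • A' μ x'))) (cvNVr d L i.m i.kk hL a ι e (fun μ x => NormedSpace.exp (((((L ^ i.kk : ℕ) : ℝ))⁻¹) • gavgM (Matrix mm mm ℂ) (Fin (d + 1)) (kingPrV L i.kk i.r (cvM d L i.m i.kk hL)) A' μ x)))) (fun y y' => (CR * ((L : ℝ) ^ i.kk) ^ (-γR)) * Real.exp (-(δR * (unitTorusGeo L i.kk (cvM d L i.m i.kk hL)).dist y y'))) :=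 by
  obtain ⟨δF, CG, CA, CD, CS, P0, aP, hδF, hCG, hCA, hCD, hCS, hP0, haP, hF⟩ := hF
  obtain ⟨δD, CR, γR, aD, hδD, hCR, hγR, haD, hD⟩ := hD
  have hLpos : 0 < L := Nat.pos_of_ne_zero (NeZero.ne L)
  have hLr : (0 : ℝ) < (L : ℝ) := Nat.cast_pos.mpr hLpos
  -- the constants of n15-c∕218 (index-free)
  have hκF := @basisConst_nonneg ι _ (Matrix mm mm ℂ) Matrix.frobeniusNormedAddCommGroup Matrix.frobeniusNormedSpace e
  have hκm : (0 : ℝ) ≤ (@basisConst ι _ (Matrix mm mm ℂ) Matrix.frobeniusNormedAddCommGroup Matrix.frobeniusNormedSpace e * (2 * Real.sqrt (Fintype.card mm)) * Real.sqrt (Fintype.card mm)) := by positivity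
  have hcs : 0 ≤ B4Sect5Proof.latticeConst (d + 1) (δF / 16) := B4Sect5Proof.latticeConst_nonneg (d + 1) (by positivity)
  have hcs' : 0 ≤ B4Sect5Proof.latticeConst (d + 1) (3 * δF / 4 / 8) := B4Sect5Proof.latticeConst_nonneg (d + 1) (by positivity)
  have hS : 0 ≤ landauSmallConst ((d : ℝ) + 1) (Fintype.card ι) CG CA CD CS P0 (2 * Fintype.card ι * (@basisConst ι _ (Matrix mm mm ℂ) Matrix.frobeniusNormedAddCommGroup Matrix.frobeniusNormedSpace e * (2 * Real.sqrt (Fintype.card mm)) * Real.sqrt (Fintype.card mm))) (2 * ((d : ℝ) + 1) * (2 * Fintype.card ι * (@basisConst ι _ (Matrix mm mm ℂ) Matrix.frobeniusNormedAddCommGroup Matrix.frobeniusNormedSpace e * (2 * Real.sqrt (Fintype.card mm)) * Real.sqrt (Fintype.card mm)))) 1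
      (B4Sect5Proof.latticeConst (d + 1) (δF / 16)) δF := by
    unfold landauSmallConst CovLandau.cK1 CovLandau.cB0 CovLandau.cM2 CovLandau.cPG0 CovLandau.cA0; positivity
  have hthr : 0 < landauExpThreshold ((d : ℝ) + 1) (Fintype.card ι) (@basisConst ι _ (Matrix mm mm ℂ) Matrix.frobeniusNormedAddCommGroup Matrix.frobeniusNormedSpace e * (2 * Real.sqrt (Fintype.card mm)) * Real.sqrt (Fintype.card mm)) CG CA CD CS P0 (B4Sect5Proof.latticeConst (d + 1) (δF / 16)) δF := by
    unfold landauExpThreshold; positivity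
  have hcR : 0 ≤ landauRowConst ((d : ℝ) + 1) (Fintype.card ι) CG CA CD CS P0 (2 * Fintype.card ι * (@basisConst ι _ (Matrix mm mm ℂ) Matrix.frobeniusNormedAddCommGroup Matrix.frobeniusNormedSpace e * (2 * Real.sqrt (Fintype.card mm)) * Real.sqrt (Fintype.card mm))) (2 * ((d : ℝ) + 1) * (2 * Fintype.card ι * (@basisConst ι _ (Matrix mm mm ℂ) Matrix.frobeniusNormedAddCommGroup Matrix.frobeniusNormedSpace e * (2 * Real.sqrt (Fintype.card mm)) * Real.sqrt (Fintype.card mm)))) 1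
      (B4Sect5Proof.latticeConst (d + 1) (δF / 16)) (B4Sect5Proof.latticeConst (d + 1) (3 * δF / 4 / 8)) δF := by
    unfold landauRowConst
    exact landauLetterConst_nonneg (by positivity) (by positivity) hcs' (by positivity) (by unfold CovLandau.cM2 CovLandau.cA0; positivity) hCD hP0
      (by unfold CovLandau.cPG0 CovLandau.cA0; positivity) (by norm_num) (by positivity)
  refine ⟨min (3 * δF / 8) δD, _, CR, γR, min aP (min aD (landauExpThreshold ((d : ℝ) + 1) (Fintype.card ι) (@basisConst ι _ (Matrix mm mm ℂ) Matrix.frobeniusNormedAddCommGroup Matrix.frobeniusNormedSpace e * (2 * Real.sqrt (Fintype.card mm)) * Real.sqrt (Fintype.card mm)) CG CA CD CS P0 (B4Sect5Proof.latticeConst (d + 1) (δF / 16)) δF / c35)),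
    lt_min (by positivity) hδD, hcR, hCR, hγR, lt_min haP (lt_min haD (by positivity)), fun i α₀ hα₀ hMa A' hA' => ?_⟩
  -- the class, the sizes
  have hMaP : (L : ℝ) ^ i.m * α₀ ≤ aP := hMa.trans (min_le_left _ _)
  have hMaD : (L : ℝ) ^ i.m * α₀ ≤ aD := hMa.trans ((min_le_right _ _).trans (min_le_left _ _))
  have hMaT : (L : ℝ) ^ i.m * α₀ ≤ landauExpThreshold ((d : ℝ) + 1) (Fintype.card ι) (@basisConst ι _ (Matrix mm mm ℂ) Matrix.frobeniusNormedAddCommGroup Matrix.frobeniusNormedSpace e * (2 * Real.sqrt (Fintype.card mm)) * Real.sqrt (Fintype.card mm)) CG CA CD CS P0 (B4Sect5Proof.latticeConst (d + 1) (δF / 16)) δF / c35 :=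
    hMa.trans ((min_le_right _ _).trans (min_le_right _ _))
  have hrA0 : 0 ≤ c35 * (L : ℝ) ^ i.m * α₀ := by positivity
  have hrT : c35 * (L : ℝ) ^ i.m * α₀ ≤ landauExpThreshold ((d : ℝ) + 1) (Fintype.card ι) (@basisConst ι _ (Matrix mm mm ℂ) Matrix.frobeniusNormedAddCommGroup Matrix.frobeniusNormedSpace e * (2 * Real.sqrt (Fintype.card mm)) * Real.sqrt (Fintype.card mm)) CG CA CD CS P0 (B4Sect5Proof.latticeConst (d + 1) (δF / 16)) δF := by
    have := mul_le_mul_of_nonneg_left hMaT hc35.le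
    rw [mul_div_cancel₀ _ hc35.ne'] at this
    simpa only [mul_assoc] using this
  obtain ⟨hskew, h1F, h2F, h3F⟩ := (sfInstance_reg335_iff d mm ι hL i c35 α₀ A').1 hA'
  have h1 : ∀ μ x', ‖A' μ x'‖ ≤ c35 * (L : ℝ) ^ i.m * α₀ := fun μ x' => (l2_opNorm_le_frobenius_norm _).trans (h1F μ x')
  have hĀs : ∀ μ x, (gavgM (Matrix mm mm ℂ) (Fin (d + 1)) (kingPrV L i.kk i.r (cvM d L i.m i.kk hL)) A' μ x)ᴴ = -gavgM (Matrix mm mm ℂ) (Fin (d + 1)) (kingPrV L i.kk i.r (cvM d L i.m i.kk hL)) A' μ x :=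
    fun μ x => gavgM_conjTranspose_of_skew (kingPrV L i.kk i.r (cvM d L i.m i.kk hL)) hskew μ x
  have hĀ : ∀ μ x, ‖gavgM (Matrix mm mm ℂ) (Fin (d + 1)) (kingPrV L i.kk i.r (cvM d L i.m i.kk hL)) A' μ x‖ ≤ c35 * (L : ℝ) ^ i.m * α₀ :=
    fun μ x => (l2_opNorm_le_frobenius_norm _).trans (norm_gavgM_le_of_norm_le d mm hL i hrA0 h1F μ x)
  obtain ⟨⟨hG1c, hA1c, hD1c, hS1c⟩, ⟨hG1f, hA1f, hD1f, hS1f⟩, hP⟩ := hF i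
  obtain ⟨hPc, hPf⟩ := hP α₀ hα₀ hMaP A' hA'
  -- n15-c∕218 on both grids
  have keyC := hasMaj_landauCov_sub_exp_of_flat (cvM d L i.m i.kk hL) (L ^ i.kk) L i.kk e hĀs hrA0 hĀ hδF hCG hCA hCD hCS hP0 hG1c hA1c hD1c hS1c hPc hrT
  have keyF := hasMaj_landauCov_sub_exp_of_flat (cvM d L i.m i.kk hL) (L ^ i.r * L ^ i.kk) L i.kk e hskew hrA0 h1 hδF hCG hCA hCD hCS hP0 hG1f hA1f hD1f hS1f hPf hrT
  have hd0 := unitTorusGeo_dist_nonneg L i.kk (cvM d L i.m i.kk hL)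
  -- unitarity and masses
  have hUc : ∀ ν (p : CvX d L i.m i.kk hL), ((fun μ x => NormedSpace.exp (((((L ^ i.kk : ℕ) : ℝ))⁻¹) • gavgM (Matrix mm mm ℂ) (Fin (d + 1)) (kingPrV L i.kk i.r (cvM d L i.m i.kk hL)) A' μ x)) ν p)ᴴ * (fun μ x => NormedSpace.exp (((((L ^ i.kk : ℕ) : ℝ))⁻¹) • gavgM (Matrix mm mm ℂ) (Fin (d + 1)) (kingPrV L i.kk i.r (cvM d L i.m i.kk hL)) A' μ x)) ν p = 1 := fun ν p => exp_smul_unitary_of_conjTranspose (hĀs ν p) _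
  have hUf : ∀ ν (p : CvX' d L i.m i.kk i.r hL), ((fun μ x' => NormedSpace.exp (((((L ^ i.r * L ^ i.kk : ℕ) : ℝ))⁻¹) • A' μ x')) ν p)ᴴ * (fun μ x' => NormedSpace.exp (((((L ^ i.r * L ^ i.kk : ℕ) : ℝ))⁻¹) • A' μ x')) ν p = 1 := fun ν p => exp_smul_unitary_of_conjTranspose (hskew ν p) _
  have hTc := isUnit_cvT₀ e hUc
  have hTf := isUnit_cvT₀ e hUf
  have haC : (0 : ℝ) < (((L ^ i.kk : ℕ) : ℝ) ^ (d + 1)) := pow_pos (Nat.cast_pos.mpr (pow_pos hLpos _)) _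
  have haF : (0 : ℝ) < (((L ^ i.r * L ^ i.kk : ℕ) : ℝ) ^ (d + 1)) := pow_pos (Nat.cast_pos.mpr (Nat.mul_pos (pow_pos hLpos _) (pow_pos hLpos _))) _
  refine ⟨?_, ?_, ?_⟩
  · -- the coarse global row
    rw [cvNVr, cvLandau, landauCov_eq_of_mass _ _ hTc ha haC, ← landauCov_one_eq _ _ haC ι, ← mulVecLin_sub']
    exact keyC.of_rate_le hd0 (mul_nonneg hcR hrA0) (min_le_left _ _)
  · -- the fine global row: the knit's fine block map IS King's block map at the fine spacing
    have hBN : BlockNorm.ofBlocks (unitTorusGeo L i.kk (cvM d L i.m i.kk hL)) (liftBlk (cvBlk d L i.m i.kk hL ∘ (kingPrV L i.kk i.r (cvM d L i.m i.kk hL))) ι) =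
        BlockNorm.ofBlocks (unitTorusGeo L i.kk (cvM d L i.m i.kk hL)) (liftBlk (fun b : Tor (fine (L ^ i.r * L ^ i.kk) (cvM d L i.m i.kk hL)) × Fin (d + 1) => blockOf (L ^ i.r * L ^ i.kk) (cvM d L i.m i.kk hL) b.1) ι) := by
      congr 1
      funext p
      exact congrFun (blkFine_comp_kingPrV (cvM d L i.m i.kk hL) L i.kk i.r) p.1
    rw [hBN, cvNVr', cvLandau', landauCov_eq_of_mass _ _ hTf ha haF, ← landauCov_one_eq _ _ haF ι, ← mulVecLin_sub']
    exact keyF.of_rate_le hd0 (mul_nonneg hcR hrA0) (min_le_left _ _)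
  · -- the two-grid defect row (displayed)
    exact (hD i α₀ hα₀ hMaD A' hA').of_rate_le hd0 (mul_nonneg hCR (Real.rpow_nonneg (pow_pos hLr _).le _)) (min_le_right _ _)

/-- ★★ (MASS WINDOW `a_w·n^{d+1}`, `0 < a_w ≤ 1`, per index and grid — the King-model rung's form.) **THE THREE THRESHOLDED GLOBAL LANDAU ROWS OF n15-c∕207b FROM n15-c∕219's DISPLAYED PRIMITIVE DATA** (n15-c∕219 `ne2PlusOperator_sfqr_of_flatRows_mass`'s own reduction, NAMED so
that the site and unit layers of the (P-R) one-propagator literal consume the SAME display): for odd `L`, `a, c₃₅ > 0` and coordinates `e`, the four FLAT rows per grid at the masses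
`a_w·n^{d+1}` (`hF`, first two blocks), the ONE covariant gradient-difference row per grid below `a_P` (`hF`, third block) and the two-grid η-defect row of `N_V^R` below `a_D` (`hD`) give
n15-c∕207b's hypothesis `hG` LITERALLY: `∃ δ_R c_R C_R γ_R a_G`, the coarse row `N_V^R(e^{ηĀ′}) ≤ c_R·r_A·e^{−δ_R d}`, the fine row `N_V^R′(e^{η′A′}) ≤ c_R·r_A·e^{−δ_R d}` and the defect row
`𝔇(N_V^R′, N_V^R) ≤ C_R(L^k)^{−γ_R}e^{−δ_R d}` for every index, every `α₀ > 0` with `L^mα₀ ≤ a_G` and every class-(3.35) field — `δ_R = min(3δ_F∕8, δ_D)`, `c_R = landauRowConst(…)`,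
`a_G = min(a_P, a_D, landauExpThreshold∕c₃₅)`; n15-c∕218 on both grids, mass moved by n15-c∕210, fine block map = King's (`blkFine_comp_kingPrV`).  Proof text = n15-c∕219's, minus its
last line.  MODEL; the rows are HYPOTHESES; NOT [B9] Thms 3.1–3.4 as printed.
[cite: Balaban1985BackgroundPropagators, (3.49) p.399, Thm 3.4 p.400, (3.25)–(3.26) pp.394–395, (3.35)–(3.37) p.396 (shape); Balaban1984PropagatorsII, Props. 2.2–2.3 pp.228–231 (the flat rows' shape)] -/
theorem landauRows_small_of_flatRows_mass (hL : Odd L ∧ 1 < L) {a : ℝ} (ha : 0 < a) {c35 : ℝ} (hc35 : 0 < c35)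
    (hF : ∃ δF CG CA CD CS P0 aP : ℝ, 0 < δF ∧ 0 ≤ CG ∧ 0 ≤ CA ∧ 0 ≤ CD ∧ 0 ≤ CS ∧ 0 ≤ P0 ∧ 0 < aP ∧ ∀ i : SfIdx d L, ∃ awC awF : ℝ, 0 < awC ∧ awC ≤ 1 ∧ 0 < awF ∧ awF ≤ 1 ∧
        (HasMaj (BlockNorm.ofBlocks (unitTorusGeo L i.kk (cvM d L i.m i.kk hL)) (liftBlk (blockOf (L ^ i.kk) (cvM d L i.m i.kk hL)) ι)) (BlockNorm.ofBlocks (unitTorusGeo L i.kk (cvM d L i.m i.kk hL)) (liftBlk (blockOf (L ^ i.kk) (cvM d L i.m i.kk hL)) ι)) (Matrix.mulVecLin (cGreen (cvM d L i.m i.kk hL) (L ^ i.kk) (fun (_ : Fin (d + 1)) (_ : Tor (fine (L ^ i.kk) (cvM d L i.m i.kk hL))) => (1 : Matrix ι ι ℝ)) (awC * ((L ^ i.kk : ℕ) : ℝ) ^ (d + 1)))) (fun y y' => CG * Real.exp (-(δF * (unitTorusGeo L i.kk (cvM d L i.m i.kk hL)).dist y y'))) ∧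
          HasMaj (BlockNorm.ofBlocks (unitTorusGeo L i.kk (cvM d L i.m i.kk hL)) (liftBlk (fun b : Tor (fine (L ^ i.kk) (cvM d L i.m i.kk hL)) × Fin (d + 1) => blockOf (L ^ i.kk) (cvM d L i.m i.kk hL) b.1) ι)) (BlockNorm.ofBlocks (unitTorusGeo L i.kk (cvM d L i.m i.kk hL)) (liftBlk (blockOf (L ^ i.kk) (cvM d L i.m i.kk hL)) ι)) (Matrix.mulVecLin (cGreen (cvM d L i.m i.kk hL) (L ^ i.kk) (fun (_ : Fin (d + 1)) (_ : Tor (fine (L ^ i.kk) (cvM d L i.m i.kk hL))) => (1 : Matrix ι ι ℝ)) (awC * ((L ^ i.kk : ℕ) : ℝ) ^ (d + 1)) * (cgrad (cvM d L i.m i.kk hL) (L ^ i.kk) (fun (_ : Fin (d + 1)) (_ : Tor (fine (L ^ i.kk) (cvM d L i.m i.kk hL))) => (1 : Matrix ι ι ℝ)))ᵀ)) (fun y y' => CA * Real.exp (-(δF * (unitTorusGeo L i.kk (cvM d L i.m i.kk hL)).dist y y'))) ∧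
          HasMaj (BlockNorm.ofBlocks (unitTorusGeo L i.kk (cvM d L i.m i.kk hL)) (liftBlk (blockOf (L ^ i.kk) (cvM d L i.m i.kk hL)) ι)) (BlockNorm.ofBlocks (unitTorusGeo L i.kk (cvM d L i.m i.kk hL)) (liftBlk (fun b : Tor (fine (L ^ i.kk) (cvM d L i.m i.kk hL)) × Fin (d + 1) => blockOf (L ^ i.kk) (cvM d L i.m i.kk hL) b.1) ι)) (Matrix.mulVecLin (cgrad (cvM d L i.m i.kk hL) (L ^ i.kk) (fun (_ : Fin (d + 1)) (_ : Tor (fine (L ^ i.kk) (cvM d L i.m i.kk hL))) => (1 : Matrix ι ι ℝ)) * cGreen (cvM d L i.m i.kk hL) (L ^ i.kk) (fun (_ : Fin (d + 1)) (_ : Tor (fine (L ^ i.kk) (cvM d L i.m i.kk hL))) => (1 : Matrix ι ι ℝ)) (awC * ((L ^ i.kk : ℕ) : ℝ) ^ (d + 1)))) (fun y y' => CD * Real.exp (-(δF * (unitTorusGeo L i.kk (cvM d L i.m i.kk hL)).dist y y'))) ∧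
          HasMaj (BlockNorm.ofBlocks (unitTorusGeo L i.kk (cvM d L i.m i.kk hL)) (liftBlk (fun y : Tor (cvM d L i.m i.kk hL) => y) ι)) (BlockNorm.ofBlocks (unitTorusGeo L i.kk (cvM d L i.m i.kk hL)) (liftBlk (fun y : Tor (cvM d L i.m i.kk hL) => y) ι)) (Matrix.mulVecLin (cSop (cvM d L i.m i.kk hL) (L ^ i.kk) (fun (_ : Fin (d + 1)) (_ : Tor (fine (L ^ i.kk) (cvM d L i.m i.kk hL))) => (1 : Matrix ι ι ℝ)) (awC * ((L ^ i.kk : ℕ) : ℝ) ^ (d + 1)))⁻¹) (fun y y' => CS * ((L ^ i.kk : ℕ) : ℝ) ^ (d + 1) * Real.exp (-(δF * (unitTorusGeo L i.kk (cvM d L i.m i.kk hL)).dist y y')))) ∧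
        (HasMaj (BlockNorm.ofBlocks (unitTorusGeo L i.kk (cvM d L i.m i.kk hL)) (liftBlk (blockOf (L ^ i.r * L ^ i.kk) (cvM d L i.m i.kk hL)) ι)) (BlockNorm.ofBlocks (unitTorusGeo L i.kk (cvM d L i.m i.kk hL)) (liftBlk (blockOf (L ^ i.r * L ^ i.kk) (cvM d L i.m i.kk hL)) ι)) (Matrix.mulVecLin (cGreen (cvM d L i.m i.kk hL) (L ^ i.r * L ^ i.kk) (fun (_ : Fin (d + 1)) (_ : Tor (fine (L ^ i.r * L ^ i.kk) (cvM d L i.m i.kk hL))) => (1 : Matrix ι ι ℝ)) (awF * ((L ^ i.r * L ^ i.kk : ℕ) : ℝ) ^ (d + 1)))) (fun y y' => CG * Real.exp (-(δF * (unitTorusGeo L i.kk (cvM d L i.m i.kk hL)).dist y y'))) ∧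
          HasMaj (BlockNorm.ofBlocks (unitTorusGeo L i.kk (cvM d L i.m i.kk hL)) (liftBlk (fun b : Tor (fine (L ^ i.r * L ^ i.kk) (cvM d L i.m i.kk hL)) × Fin (d + 1) => blockOf (L ^ i.r * L ^ i.kk) (cvM d L i.m i.kk hL) b.1) ι)) (BlockNorm.ofBlocks (unitTorusGeo L i.kk (cvM d L i.m i.kk hL)) (liftBlk (blockOf (L ^ i.r * L ^ i.kk) (cvM d L i.m i.kk hL)) ι)) (Matrix.mulVecLin (cGreen (cvM d L i.m i.kk hL) (L ^ i.r * L ^ i.kk) (fun (_ : Fin (d + 1)) (_ : Tor (fine (L ^ i.r * L ^ i.kk) (cvM d L i.m i.kk hL))) => (1 : Matrix ι ι ℝ)) (awF * ((L ^ i.r * L ^ i.kk : ℕ) : ℝ) ^ (d + 1)) * (cgrad (cvM d L i.m i.kk hL) (L ^ i.r * L ^ i.kk) (fun (_ : Fin (d + 1)) (_ : Tor (fine (L ^ i.r * L ^ i.kk) (cvM d L i.m i.kk hL))) => (1 : Matrix ι ι ℝ)))ᵀ)) (fun y y' => CA * Real.exp (-(δF * (unitTorusGeo L i.kk (cvM d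 L i.m i.kk hL)).dist y y'))) ∧
          HasMaj (BlockNorm.ofBlocks (unitTorusGeo L i.kk (cvM d L i.m i.kk hL)) (liftBlk (blockOf (L ^ i.r * L ^ i.kk) (cvM d L i.m i.kk hL)) ι)) (BlockNorm.ofBlocks (unitTorusGeo L i.kk (cvM d L i.m i.kk hL)) (liftBlk (fun b : Tor (fine (L ^ i.r * L ^ i.kk) (cvM d L i.m i.kk hL)) × Fin (d + 1) => blockOf (L ^ i.r * L ^ i.kk) (cvM d L i.m i.kk hL) b.1) ι)) (Matrix.mulVecLin (cgrad (cvM d L i.m i.kk hL) (L ^ i.r * L ^ i.kk) (fun (_ : Fin (d + 1)) (_ : Tor (fine (L ^ i.r * L ^ i.kk) (cvM d L i.m i.kk hL))) => (1 : Matrix ι ι ℝ)) * cGreen (cvM d L i.m i.kk hL) (L ^ i.r * L ^ i.kk) (fun (_ : Fin (d + 1)) (_ : Tor (fine (L ^ i.r * L ^ i.kk) (cvM d L i.m i.kk hL))) => (1 : Matrix ι ι ℝ)) (awF * ((L ^ i.r * L ^ i.kk : ℕ) : ℝ) ^ (d + 1)))) (fun y y' => CD * Real.exp (-(δF * (unitTorusGeo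 L i.kk (cvM d L i.m i.kk hL)).dist y y'))) ∧
          HasMaj (BlockNorm.ofBlocks (unitTorusGeo L i.kk (cvM d L i.m i.kk hL)) (liftBlk (fun y : Tor (cvM d L i.m i.kk hL) => y) ι)) (BlockNorm.ofBlocks (unitTorusGeo L i.kk (cvM d L i.m i.kk hL)) (liftBlk (fun y : Tor (cvM d L i.m i.kk hL) => y) ι)) (Matrix.mulVecLin (cSop (cvM d L i.m i.kk hL) (L ^ i.r * L ^ i.kk) (fun (_ : Fin (d + 1)) (_ : Tor (fine (L ^ i.r * L ^ i.kk) (cvM d L i.m i.kk hL))) => (1 : Matrix ι ι ℝ)) (awF * ((L ^ i.r * L ^ i.kk : ℕ) : ℝ) ^ (d + 1)))⁻¹) (fun y y' => CS * ((L ^ i.r * L ^ i.kk : ℕ) : ℝ) ^ (d + 1) * Real.exp (-(δF * (unitTorusGeo L i.kk (cvM d L i.m i.kk hL)).dist y y')))) ∧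
        (∀ α₀ : ℝ, 0 < α₀ → (L : ℝ) ^ i.m * α₀ ≤ aP → ∀ A' : Fin (d + 1) → CvX' d L i.m i.kk i.r hL → Matrix mm mm ℂ, (sfInstance d mm ι hL i).Bf.Reg335 c35 α₀ A' →
          HasMaj (BlockNorm.ofBlocks (unitTorusGeo L i.kk (cvM d L i.m i.kk hL)) (liftBlk (blockOf (L ^ i.kk) (cvM d L i.m i.kk hL)) ι)) (BlockNorm.ofBlocks (unitTorusGeo L i.kk (cvM d L i.m i.kk hL)) (liftBlk (fun b : Tor (fine (L ^ i.kk) (cvM d L i.m i.kk hL)) × Fin (d + 1) => blockOf (L ^ i.kk) (cvM d L i.m i.kk hL) b.1) ι)) (Matrix.mulVecLin (cgrad (cvM d L i.m i.kk hL) (L ^ i.kk) (cvT₀ e (fun μ x => NormedSpace.exp (((((L ^ i.kk : ℕ) : ℝ))⁻¹) • gavgM (Matrix mm mm ℂ) (Fin (d + 1)) (kingPrV L i.kk i.r (cvM d L i.m i.kk hL)) A' μ x))) * cGreen (cvM d L i.m i.kk hL) (L ^ i.kk) (cvT₀ e (fun μ x => NormedSpace.exp (((((L ^ i.kk : ℕ)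 : ℝ))⁻¹) • gavgM (Matrix mm mm ℂ) (Fin (d + 1)) (kingPrV L i.kk i.r (cvM d L i.m i.kk hL)) A' μ x))) (awC * ((L ^ i.kk : ℕ) : ℝ) ^ (d + 1)) - cgrad (cvM d L i.m i.kk hL) (L ^ i.kk) (fun (_ : Fin (d + 1)) (_ : Tor (fine (L ^ i.kk) (cvM d L i.m i.kk hL))) => (1 : Matrix ι ι ℝ)) * cGreen (cvM d L i.m i.kk hL) (L ^ i.kk) (fun (_ : Fin (d + 1)) (_ : Tor (fine (L ^ i.kk) (cvM d L i.m i.kk hL))) => (1 : Matrix ι ι ℝ)) (awC * ((L ^ i.kk : ℕ) : ℝ) ^ (d + 1)))) (fun y y' => P0 * (c35 * (L : ℝ) ^ i.m * α₀) * Real.exp (-(δF * (unitTorusGeo L i.kk (cvM d L i.m i.kk hL)).dist y y'))) ∧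
          HasMaj (BlockNorm.ofBlocks (unitTorusGeo L i.kk (cvM d L i.m i.kk hL)) (liftBlk (blockOf (L ^ i.r * L ^ i.kk) (cvM d L i.m i.kk hL)) ι)) (BlockNorm.ofBlocks (unitTorusGeo L i.kk (cvM d L i.m i.kk hL)) (liftBlk (fun b : Tor (fine (L ^ i.r * L ^ i.kk) (cvM d L i.m i.kk hL)) × Fin (d + 1) => blockOf (L ^ i.r * L ^ i.kk) (cvM d L i.m i.kk hL) b.1) ι)) (Matrix.mulVecLin (cgrad (cvM d L i.m i.kk hL) (L ^ i.r * L ^ i.kk) (cvT₀ e (fun μ x' => NormedSpace.exp (((((L ^ i.r * L ^ i.kk : ℕ) : ℝ))⁻¹) • A' μ x'))) * cGreen (cvM d L i.m i.kk hL) (L ^ i.r * L ^ i.kk) (cvT₀ e (fun μ x' => NormedSpace.exp (((((L ^ i.r * L ^ i.kk : ℕ) : ℝ))⁻¹) • A' μ x'))) (awF * ((L ^ i.r * L ^ i.kk : ℕ) : ℝ) ^ (d + 1)) - cgrad (cvM d L i.m i.kk hL) (L ^ i.r * L ^ i.kk) (fun (_ : Fin (d + 1)) (_ : Tor (fine (L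 ^ i.r * L ^ i.kk) (cvM d L i.m i.kk hL))) => (1 : Matrix ι ι ℝ)) * cGreen (cvM d L i.m i.kk hL) (L ^ i.r * L ^ i.kk) (fun (_ : Fin (d + 1)) (_ : Tor (fine (L ^ i.r * L ^ i.kk) (cvM d L i.m i.kk hL))) => (1 : Matrix ι ι ℝ)) (awF * ((L ^ i.r * L ^ i.kk : ℕ) : ℝ) ^ (d + 1)))) (fun y y' => P0 * (c35 * (L : ℝ) ^ i.m * α₀) * Real.exp (-(δF * (unitTorusGeo L i.kk (cvM d L i.m i.kk hL)).dist y y')))))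
    (hD : ∃ δD CR γR aD : ℝ, 0 < δD ∧ 0 ≤ CR ∧ 0 < γR ∧ 0 < aD ∧
      ∀ i : SfIdx d L, ∀ α₀ : ℝ, 0 < α₀ → (L : ℝ) ^ i.m * α₀ ≤ aD → ∀ A' : Fin (d + 1) → CvX' d L i.m i.kk i.r hL → Matrix mm mm ℂ, (sfInstance d mm ι hL i).Bf.Reg335 c35 α₀ A' →
        HasMaj (CvNorm d L i.m i.kk hL ι) (BlockNorm.ofBlocks (unitTorusGeo L i.kk (cvM d L i.m i.kk hL)) (liftBlk (cvBlk d L i.m i.kk hL ∘ (kingPrV L i.kk i.r (cvM d L i.m i.kk hL))) ι)) (idef (pull (liftMap (kingPrV L i.kk i.r (cvM d L i.m i.kk hL)) ι)) (pull (liftMap (kingPrV L i.kk i.r (cvM d L i.m i.kk hL)) ι)) (cvNVr' d L i.m i.kk i.r hL a ι e (fun μ x' => NormedSpace.exp (((((L ^ i.r * L ^ i.kk : ℕ) : ℝ))⁻¹) • A' μ x'))) (cvNVr d L i.m i.kk hL a ι e (fun μ x => NormedSpace.exp (((((L ^ i.kk : ℕ) : ℝ))⁻¹) • gavgM (Matrix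 mm mm ℂ) (Fin (d + 1)) (kingPrV L i.kk i.r (cvM d L i.m i.kk hL)) A' μ x)))) (fun y y' => (CR * ((L : ℝ) ^ i.kk) ^ (-γR)) * Real.exp (-(δD * (unitTorusGeo L i.kk (cvM d L i.m i.kk hL)).dist y y')))) :
    ∃ δR cR CR γR aG : ℝ, 0 < δR ∧ 0 ≤ cR ∧ 0 ≤ CR ∧ 0 < γR ∧ 0 < aG ∧
      ∀ i : SfIdx d L, ∀ α₀ : ℝ, 0 < α₀ → (L : ℝ) ^ i.m * α₀ ≤ aG → ∀ A' : Fin (d + 1) → CvX' d L i.m i.kk i.r hL → Matrix mm mm ℂ, (sfInstance d mm ι hL i).Bf.Reg335 c35 α₀ A' →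
        HasMaj (CvNorm d L i.m i.kk hL ι) (CvNorm d L i.m i.kk hL ι) (cvNVr d L i.m i.kk hL a ι e (fun μ x => NormedSpace.exp (((((L ^ i.kk : ℕ) : ℝ))⁻¹) • gavgM (Matrix mm mm ℂ) (Fin (d + 1)) (kingPrV L i.kk i.r (cvM d L i.m i.kk hL)) A' μ x))) (fun y y' => (cR * (c35 * (L : ℝ) ^ i.m * α₀)) * Real.exp (-(δR * (unitTorusGeo L i.kk (cvM d L i.m i.kk hL)).dist y y'))) ∧
        HasMaj (BlockNorm.ofBlocks (unitTorusGeo L i.kk (cvM d L i.m i.kk hL)) (liftBlk (cvBlk d L i.m i.kk hL ∘ (kingPrV L i.kk i.r (cvM d L i.m i.kk hL))) ι)) (BlockNorm.ofBlocks (unitTorusGeo L i.kk (cvM d L i.m i.kk hL)) (liftBlk (cvBlk d L i.m i.kk hL ∘ (kingPrV L i.kk i.r (cvM d L i.m i.kk hL))) ι)) (cvNVr' d L i.m i.kk i.r hL a ι e (fun μ x' => NormedSpace.exp (((((L ^ i.r * L ^ i.kk : ℕ) : ℝ))⁻¹) • A' μ x'))) (fun y y' => (cR * (c35 * (L : ℝ)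 ^ i.m * α₀)) * Real.exp (-(δR * (unitTorusGeo L i.kk (cvM d L i.m i.kk hL)).dist y y'))) ∧
        HasMaj (CvNorm d L i.m i.kk hL ι) (BlockNorm.ofBlocks (unitTorusGeo L i.kk (cvM d L i.m i.kk hL)) (liftBlk (cvBlk d L i.m i.kk hL ∘ (kingPrV L i.kk i.r (cvM d L i.m i.kk hL))) ι)) (idef (pull (liftMap (kingPrV L i.kk i.r (cvM d L i.m i.kk hL)) ι)) (pull (liftMap (kingPrV L i.kk i.r (cvM d L i.m i.kk hL)) ι)) (cvNVr' d L i.m i.kk i.r hL a ι e (fun μ x' => NormedSpace.exp (((((L ^ i.r * L ^ i.kk : ℕ) : ℝ))⁻¹) • A' μ x'))) (cvNVr d L i.m i.kk hL a ι e (fun μ x => NormedSpace.exp (((((L ^ i.kk : ℕ) : ℝ))⁻¹) • gavgM (Matrix mm mm ℂ) (Fin (d + 1)) (kingPrV L i.kk i.r (cvM d L i.m i.kk hL)) A' μ x)))) (fun y y' => (CR * ((L : ℝ) ^ i.kk) ^ (-γR)) * Real.exp (-(δR * (unitTorusGeo L i.kk (cvM d L i.m i.kk hL)).dist y y'))) :=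 by
  obtain ⟨δF, CG, CA, CD, CS, P0, aP, hδF, hCG, hCA, hCD, hCS, hP0, haP, hF⟩ := hF
  obtain ⟨δD, CR, γR, aD, hδD, hCR, hγR, haD, hD⟩ := hD
  have hLpos : 0 < L := Nat.pos_of_ne_zero (NeZero.ne L)
  have hLr : (0 : ℝ) < (L : ℝ) := Nat.cast_pos.mpr hLpos
  -- the constants of n15-c∕218 (index-free)
  have hκF := @basisConst_nonneg ι _ (Matrix mm mm ℂ) Matrix.frobeniusNormedAddCommGroup Matrix.frobeniusNormedSpace e
  have hκm : (0 : ℝ) ≤ (@basisConst ι _ (Matrix mm mm ℂ) Matrix.frobeniusNormedAddCommGroup Matrix.frobeniusNormedSpace e * (2 * Real.sqrt (Fintype.card mm)) * Real.sqrt (Fintype.card mm)) := by positivity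
  have hcs : 0 ≤ B4Sect5Proof.latticeConst (d + 1) (δF / 16) := B4Sect5Proof.latticeConst_nonneg (d + 1) (by positivity)
  have hcs' : 0 ≤ B4Sect5Proof.latticeConst (d + 1) (3 * δF / 4 / 8) := B4Sect5Proof.latticeConst_nonneg (d + 1) (by positivity)
  have hS : 0 ≤ landauSmallConst ((d : ℝ) + 1) (Fintype.card ι) CG CA CD CS P0 (2 * Fintype.card ι * (@basisConst ι _ (Matrix mm mm ℂ) Matrix.frobeniusNormedAddCommGroup Matrix.frobeniusNormedSpace e * (2 * Real.sqrt (Fintype.card mm)) * Real.sqrt (Fintype.card mm))) (2 * ((d : ℝ) + 1) * (2 * Fintype.card ι * (@basisConst ι _ (Matrix mm mm ℂ) Matrix.frobeniusNormedAddCommGroup Matrix.frobeniusNormedSpace e * (2 * Real.sqrt (Fintype.card mm)) * Real.sqrt (Fintype.card mm)))) 1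
      (B4Sect5Proof.latticeConst (d + 1) (δF / 16)) δF := by
    unfold landauSmallConst CovLandau.cK1 CovLandau.cB0 CovLandau.cM2 CovLandau.cPG0 CovLandau.cA0; positivity
  have hthr : 0 < landauExpThreshold ((d : ℝ) + 1) (Fintype.card ι) (@basisConst ι _ (Matrix mm mm ℂ) Matrix.frobeniusNormedAddCommGroup Matrix.frobeniusNormedSpace e * (2 * Real.sqrt (Fintype.card mm)) * Real.sqrt (Fintype.card mm)) CG CA CD CS P0 (B4Sect5Proof.latticeConst (d + 1) (δF / 16)) δF := by
    unfold landauExpThreshold; positivity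
  have hcR : 0 ≤ landauRowConst ((d : ℝ) + 1) (Fintype.card ι) CG CA CD CS P0 (2 * Fintype.card ι * (@basisConst ι _ (Matrix mm mm ℂ) Matrix.frobeniusNormedAddCommGroup Matrix.frobeniusNormedSpace e * (2 * Real.sqrt (Fintype.card mm)) * Real.sqrt (Fintype.card mm))) (2 * ((d : ℝ) + 1) * (2 * Fintype.card ι * (@basisConst ι _ (Matrix mm mm ℂ) Matrix.frobeniusNormedAddCommGroup Matrix.frobeniusNormedSpace e * (2 * Real.sqrt (Fintype.card mm)) * Real.sqrt (Fintype.card mm)))) 1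
      (B4Sect5Proof.latticeConst (d + 1) (δF / 16)) (B4Sect5Proof.latticeConst (d + 1) (3 * δF / 4 / 8)) δF := by
    unfold landauRowConst
    exact landauLetterConst_nonneg (by positivity) (by positivity) hcs' (by positivity) (by unfold CovLandau.cM2 CovLandau.cA0; positivity) hCD hP0
      (by unfold CovLandau.cPG0 CovLandau.cA0; positivity) (by norm_num) (by positivity)
  refine ⟨min (3 * δF / 8) δD, _, CR, γR, min aP (min aD (landauExpThreshold ((d : ℝ) + 1) (Fintype.card ι) (@basisConst ι _ (Matrix mm mm ℂ) Matrix.frobeniusNormedAddCommGroup Matrix.frobeniusNormedSpace e * (2 * Real.sqrt (Fintype.card mm)) * Real.sqrt (Fintype.card mm)) CG CA CD CS P0 (B4Sect5Proof.latticeConst (d + 1) (δF / 16)) δF / c35)),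
    lt_min (by positivity) hδD, hcR, hCR, hγR, lt_min haP (lt_min haD (by positivity)), fun i α₀ hα₀ hMa A' hA' => ?_⟩
  -- the class, the sizes
  have hMaP : (L : ℝ) ^ i.m * α₀ ≤ aP := hMa.trans (min_le_left _ _)
  have hMaD : (L : ℝ) ^ i.m * α₀ ≤ aD := hMa.trans ((min_le_right _ _).trans (min_le_left _ _))
  have hMaT : (L : ℝ) ^ i.m * α₀ ≤ landauExpThreshold ((d : ℝ) + 1) (Fintype.card ι) (@basisConst ι _ (Matrix mm mm ℂ) Matrix.frobeniusNormedAddCommGroup Matrix.frobeniusNormedSpace e * (2 * Real.sqrt (Fintype.card mm)) * Real.sqrt (Fintype.card mm)) CG CA CD CS P0 (B4Sect5Proof.latticeConst (d + 1) (δF / 16)) δF / c35 :=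
    hMa.trans ((min_le_right _ _).trans (min_le_right _ _))
  have hrA0 : 0 ≤ c35 * (L : ℝ) ^ i.m * α₀ := by positivity
  have hrT : c35 * (L : ℝ) ^ i.m * α₀ ≤ landauExpThreshold ((d : ℝ) + 1) (Fintype.card ι) (@basisConst ι _ (Matrix mm mm ℂ) Matrix.frobeniusNormedAddCommGroup Matrix.frobeniusNormedSpace e * (2 * Real.sqrt (Fintype.card mm)) * Real.sqrt (Fintype.card mm)) CG CA CD CS P0 (B4Sect5Proof.latticeConst (d + 1) (δF / 16)) δF := by
    have := mul_le_mul_of_nonneg_left hMaT hc35.le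
    rw [mul_div_cancel₀ _ hc35.ne'] at this
    simpa only [mul_assoc] using this
  obtain ⟨hskew, h1F, h2F, h3F⟩ := (sfInstance_reg335_iff d mm ι hL i c35 α₀ A').1 hA'
  have h1 : ∀ μ x', ‖A' μ x'‖ ≤ c35 * (L : ℝ) ^ i.m * α₀ := fun μ x' => (l2_opNorm_le_frobenius_norm _).trans (h1F μ x')
  have hĀs : ∀ μ x, (gavgM (Matrix mm mm ℂ) (Fin (d + 1)) (kingPrV L i.kk i.r (cvM d L i.m i.kk hL)) A' μ x)ᴴ = -gavgM (Matrix mm mm ℂ) (Fin (d + 1)) (kingPrV L i.kk i.r (cvM d L i.m i.kk hL)) A' μ x :=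
    fun μ x => gavgM_conjTranspose_of_skew (kingPrV L i.kk i.r (cvM d L i.m i.kk hL)) hskew μ x
  have hĀ : ∀ μ x, ‖gavgM (Matrix mm mm ℂ) (Fin (d + 1)) (kingPrV L i.kk i.r (cvM d L i.m i.kk hL)) A' μ x‖ ≤ c35 * (L : ℝ) ^ i.m * α₀ :=
    fun μ x => (l2_opNorm_le_frobenius_norm _).trans (norm_gavgM_le_of_norm_le d mm hL i hrA0 h1F μ x)
  obtain ⟨awC, awF, hawC0, hawC1, hawF0, hawF1, ⟨hG1c, hA1c, hD1c, hS1c⟩, ⟨hG1f, hA1f, hD1f, hS1f⟩, hP⟩ := hF i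
  obtain ⟨hPc, hPf⟩ := hP α₀ hα₀ hMaP A' hA'
  -- n15-c∕218 on both grids
  have keyC := hasMaj_landauCov_sub_exp_of_flat_mass (cvM d L i.m i.kk hL) (L ^ i.kk) L i.kk e hawC0 hawC1 hĀs hrA0 hĀ hδF hCG hCA hCD hCS hP0 hG1c hA1c hD1c hS1c hPc hrT
  have keyF := hasMaj_landauCov_sub_exp_of_flat_mass (cvM d L i.m i.kk hL) (L ^ i.r * L ^ i.kk) L i.kk e hawF0 hawF1 hskew hrA0 h1 hδF hCG hCA hCD hCS hP0 hG1f hA1f hD1f hS1f hPf hrT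
  have hd0 := unitTorusGeo_dist_nonneg L i.kk (cvM d L i.m i.kk hL)
  -- unitarity and masses
  have hUc : ∀ ν (p : CvX d L i.m i.kk hL), ((fun μ x => NormedSpace.exp (((((L ^ i.kk : ℕ) : ℝ))⁻¹) • gavgM (Matrix mm mm ℂ) (Fin (d + 1)) (kingPrV L i.kk i.r (cvM d L i.m i.kk hL)) A' μ x)) ν p)ᴴ * (fun μ x => NormedSpace.exp (((((L ^ i.kk : ℕ) : ℝ))⁻¹) • gavgM (Matrix mm mm ℂ) (Fin (d + 1)) (kingPrV L i.kk i.r (cvM d L i.m i.kk hL)) A' μ x)) ν p = 1 := fun ν p => exp_smul_unitary_of_conjTranspose (hĀs ν p) _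
  have hUf : ∀ ν (p : CvX' d L i.m i.kk i.r hL), ((fun μ x' => NormedSpace.exp (((((L ^ i.r * L ^ i.kk : ℕ) : ℝ))⁻¹) • A' μ x')) ν p)ᴴ * (fun μ x' => NormedSpace.exp (((((L ^ i.r * L ^ i.kk : ℕ) : ℝ))⁻¹) • A' μ x')) ν p = 1 := fun ν p => exp_smul_unitary_of_conjTranspose (hskew ν p) _
  have hTc := isUnit_cvT₀ e hUc
  have hTf := isUnit_cvT₀ e hUf
  have haC : (0 : ℝ) < (awC * ((L ^ i.kk : ℕ) : ℝ) ^ (d + 1)) := mul_pos hawC0 (pow_pos (Nat.cast_pos.mpr (pow_pos hLpos _)) _)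
  have haF : (0 : ℝ) < (awF * ((L ^ i.r * L ^ i.kk : ℕ) : ℝ) ^ (d + 1)) := mul_pos hawF0 (pow_pos (Nat.cast_pos.mpr (Nat.mul_pos (pow_pos hLpos _) (pow_pos hLpos _))) _)
  refine ⟨?_, ?_, ?_⟩
  · -- the coarse global row
    rw [cvNVr, cvLandau, landauCov_eq_of_mass _ _ hTc ha haC, ← landauCov_one_eq _ _ haC ι, ← mulVecLin_sub']
    exact keyC.of_rate_le hd0 (mul_nonneg hcR hrA0) (min_le_left _ _)
  · -- the fine global row: the knit's fine block map IS King's block map at the fine spacing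
    have hBN : BlockNorm.ofBlocks (unitTorusGeo L i.kk (cvM d L i.m i.kk hL)) (liftBlk (cvBlk d L i.m i.kk hL ∘ (kingPrV L i.kk i.r (cvM d L i.m i.kk hL))) ι) =
        BlockNorm.ofBlocks (unitTorusGeo L i.kk (cvM d L i.m i.kk hL)) (liftBlk (fun b : Tor (fine (L ^ i.r * L ^ i.kk) (cvM d L i.m i.kk hL)) × Fin (d + 1) => blockOf (L ^ i.r * L ^ i.kk) (cvM d L i.m i.kk hL) b.1) ι) := by
      congr 1
      funext p
      exact congrFun (blkFine_comp_kingPrV (cvM d L i.m i.kk hL) L i.kk i.r) p.1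
    rw [hBN, cvNVr', cvLandau', landauCov_eq_of_mass _ _ hTf ha haF, ← landauCov_one_eq _ _ haF ι, ← mulVecLin_sub']
    exact keyF.of_rate_le hd0 (mul_nonneg hcR hrA0) (min_le_left _ _)
  · -- the two-grid defect row (displayed)
    exact (hD i α₀ hα₀ hMaD A' hA').of_rate_le hd0 (mul_nonneg hCR (Real.rpow_nonneg (pow_pos hLr _).le _)) (min_le_right _ _)

end Node

end Summit.QuantumFields.YangMills.BalabanUVNodes.N15.Gluing

end
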